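import Summits.BirchSwinnertonDyer.BirchSwinnertonDyer.Theorems.RamifiedHeegnerPairLeafRankOneUpperAtThreeShimuraInertCoreAt
import Summits.BirchSwinnertonDyer.BirchSwinnertonDyer.Theorems.RamifiedHeegnerPairLeafRankOneUpperAtThreeShimuraInertTwoCarriers
import Summits.BirchSwinnertonDyer.BirchSwinnertonDyer.Theorems.ClassRecordThreeShimuraKolyvaginOrderBoundAtThreeSurjOfNamedPrimitivesAtThree
import HarnessLib

/-!
# Route `RamifiedHeegnerPair`, crux U₁ `LeafRankOneUpperAtThree` (stmt-BirchSwinnertonDyer-26022), line `splitkolyvagin` —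
# the INERT-CARRIER (Shimura-curve) road, part 8: the two SOURCES of the Heegner datum, and the ONTO rows from printed primitives

HONEST FRAMING. Theorems only; helper file (`--supports stmt-BirchSwinnertonDyer-26022 --as helper`); nothing is booked, no item is
closed, BSD is not proved for any curve; CONDITIONAL on every displayed input. Lead prover bsd-line-rhp-p2 g10, 2026-08-28. Sequel of
part 7 (`…ShimuraInertCoreAt.lean`: the core with the Heegner datum asked AT THE DATUM).

WHY. Parts 2–6 take the Shimura-curve input as the ONE named fact `shimuraCurve_heegnerPoint_grossZagier_kolyvagin`, whose Kolyvagin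
conjunct at `3 ∣ N⁺` is JSW 2017 Thm. 4.4.1 AS PRINTED (reading flag `JSW17-Thm441-Nekovar-primary`). Cell bsd-stepL (seat shim-p2, crux
19899 of `ClassRecordThree`/`KolyvaginRoadThree`) PROVED that order bound IN THE KERNEL at `p = 3 ∣ N` for curves with `ρ̄₃` ONTO, from
Poitou–Tate (sum form), GZK, modularity, the Cassels–Tate level inputs and the printed Heegner-system primitives of `X_{N⁺,N⁻}`
(`ShimuraKolyvaginSurjNamedPrimitivesAtThree.shimuraKolyvaginOrderBoundAtThreeSurj_of_…`,
`Theorems/ClassRecordThreeShimuraKolyvaginOrderBoundAtThreeSurjOfNamedPrimitivesAtThree.lean`) — a statement with NO reduction condition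
at `3` (the primitives fact `shimuraCurve_heegnerSystem_primitivesAtThree` is typed without one either: its printed relations (B1)–(B5)
live at the bottom point and at Kolyvagin primes `ℓ ∤ N`; its docstring's locus is the X11b one, `3 ∥ N⁺` — READING recorded, not
re-audited here). Census: 105 of the 116 Shimura rows (rank-one Gss2, `N < 5·10⁵`) have `ρ̄₃` onto.

* `shimuraHeegnerAt_of_fact` — source 1 (the named fact, all rows with `E[3]` irreducible);
* `shimuraHeegnerAt_of_primitives_of_surj` — source 2 (printed companion `shimuraCurve_heegnerPoint_grossZagier` + the kernel bound; ONTO rows);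
* `leafRankOneUpper_three_of_twoCarriers_of_lowerRankZero_of_primitives` — U₁ at a leaf curve with `ρ̄₃` onto on a two-carrier Shimura row
  from PRINTED THEOREMS taken by name {GZK, modularity ×2, Jacquet–Langlands, Pasten 2024 §6 component orders, Cai–Shu–Tian Thm 1.5
  (companion), Poitou–Tate, Cassels–Tate level inputs, Heegner-system primitives at `3`, Friedberg–Hoffstein inert-split} and L₀ — no Σ, no
  JSW flag.

References: [cite: McCallumLMS1991, §1 Theorem (Kolyvagin)] [cite: GrossLMS1991, §§3–5] [cite: CaiShuTian2014, Thm. 1.5]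
[cite: BertoliniDarmon1996, §2.3, Prop. 2.6] [cite: JetchevSkinnerWan2017, §7.4.2 (p. 31), Thm. 4.4.1 (p. 19)]
[cite: PastenShimura2024, Prop. 6.13, Lemma 6.18 (pp. 23–24)] [cite: FriedbergHoffstein1995, Thm. B] [cite: Miller2011LMS, Def. 1.1].
-/

-- D-0017: single-problem summit, so `Summit.BirchSwinnertonDyer.BirchSwinnertonDyer.…` repeats a namespace BY DESIGN.
set_option linter.dupNamespace false
set_option autoImplicit false

noncomputable section

open scoped Classical NumberField

open WeierstrassCurve NumberField IsDedekindDomain Literature Literature.NumberTheory.EllipticCurves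
  Rat.HeightOneSpectrum CongruenceSubgroup
  Literature.NumberTheory.EllipticCurves.ModularForms
  Literature.NumberTheory.EllipticCurves.Rank1Residual
  Literature.NumberTheory.EllipticCurves.Rank1Residual.Typed
  Literature.NumberTheory.QuadraticFields.Quadratic
  Literature.NumberTheory.GaloisCohomology
  Literature.NumberTheory.Automorphic
  Summit.BirchSwinnertonDyer.Rank1Residual
  Summit.BirchSwinnertonDyer.Rank1Residual.Additive
  Summit.BirchSwinnertonDyer.Rank1Residual.X11b
  Summit.BirchSwinnertonDyer.Rank1Residual.X11b.Three
  Summit.BirchSwinnertonDyer.BirchSwinnertonDyer.Theses.RamifiedHeegnerPair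
  Summit.BirchSwinnertonDyer.BirchSwinnertonDyer.Theorems

namespace Summit.BirchSwinnertonDyer.BirchSwinnertonDyer.Theorems.LeafShimuraInert

/-! ## §10 The two sources of the Heegner datum, and the ONTO-row theorems from printed primitives -/

section Sources

variable (W : WeierstrassCurve ℚ) [W.IsElliptic] [W.IsGloballyMinimal]
  {N : ℕ} [NeZero N] (hN : W.conductorNorm ℤ = N)
  (K : Type) [Field K] [NumberField K] (hK : IsImaginaryQuadratic K)
  (S : Finset ℕ) (hSeven : Even S.card)
  (hSin : ∀ ℓ ∈ S, ℓ.Prime ∧ ℓ ∣ N ∧ ¬ ℓ ^ 2 ∣ N ∧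
    ((Ideal.span {(ℓ : ℤ)}).primesOver (𝓞 K)).ncard = 1 ∧ ¬ (ℓ : ℤ) ∣ NumberField.discr K)
  (hsplitN : ∀ ℓ : ℕ, ℓ.Prime → ℓ ∣ N → ℓ ∉ S → ((Ideal.span {(ℓ : ℤ)}).primesOver (𝓞 K)).ncard = 2)
  (h3 : ((Ideal.span {((3 : ℕ) : ℤ)}).primesOver (𝓞 K)).ncard = 2)
  (Dt : ModularParametrizationData W N)

include hN hK hSeven hSin hsplitN h3

/-- **Source 1: the named fact** `shimuraCurve_heegnerPoint_grossZagier_kolyvagin` (CST14 Thm. 1.5 + JSW17 Thm. 4.4.1 AS PRINTED) gives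
the Heegner datum at `(W, 3, N, K, S, Dt)` for `W[3]` irreducible. [cite: CaiShuTian2014, Thm. 1.5] [cite: JetchevSkinnerWan2017, Thm. 4.4.1 (p. 19)] -/
theorem shimuraHeegnerAt_of_fact (hHK : shimuraCurve_heegnerPoint_grossZagier_kolyvagin)
    (hirr : W.HasIrreducibleModPGaloisRep 3) :
    ∀ (X : ShimuraCurveData (∏ q ∈ S, q) (N / ∏ q ∈ S, q)) (W' : WeierstrassCurve ℚ) [W'.IsElliptic]
      (P₀ : ShimuraParametrizationData X W'), P₀.IsMinimalFor W →
      ∃ (P : (W.baseChange K).toAffine.Point) (degS : ℕ), 0 < degS ∧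
        padicValNat 3 degS = padicValNat 3 P₀.deg ∧
        LDerivEK W K =
          8 * (Real.pi : ℂ) ^ 2 * peterssonProduct (Gamma0 N) 2 Dt.f Dt.f /
              ((((Units.torsionOrder K : ℝ) / 2) ^ 2 * √|(NumberField.discr K : ℝ)| : ℝ) : ℂ) *
            ((P.canonicalHeight : ℂ) / (degS : ℂ)) ∧
        (¬ IsOfFinAddOrder P →
          Nat.card (AddCommGroup.primaryComponent (W.baseChange K).sha 3) ≤
            3 ^ (2 * padicValNat 3 (AddSubgroup.zmultiples P).index)) := by
  haveI : Fact (Nat.Prime 3) := ⟨Nat.prime_three⟩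
  intro X W' _ P₀ hP₀
  exact hHK W 3 N K S Dt X W' P₀ hN (by decide) hirr hK hSeven hSin hsplitN h3 hP₀

/-- **Source 2 (the `ρ̄₃`-ONTO rows): the printed companion + bsd-stepL's KERNEL Kolyvagin bound from the printed Heegner-system
primitives.** The point and its Cai–Shu–Tian display from `shimuraCurve_heegnerPoint_grossZagier` (conjuncts 1–3 of the fact — printed
theorems), the order bound `#Ш(E/K)[3^∞] ≤ 3^{2·ord₃[E(K):ℤP]}` from
`ShimuraKolyvaginSurjNamedPrimitivesAtThree.shimuraKolyvaginOrderBoundAtThreeSurj_of_…` (Poitou–Tate in sum form, GZK, modularity,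
`casselsTate_levelInputs`, `shimuraCurve_heegnerSystem_primitivesAtThree`; `Surj W 3`, `3 ∣ N` — no reduction condition at `3`). No
JSW flag. [cite: McCallumLMS1991, §1 Theorem (Kolyvagin)] [cite: CaiShuTian2014, Thm. 1.5] [cite: GrossLMS1991, §§3–5]
[cite: BertoliniDarmon1996, §2.3, Prop. 2.6] -/
theorem shimuraHeegnerAt_of_primitives_of_surj
    (hGZ3 : shimuraCurve_heegnerPoint_grossZagier)
    (hPT : ∀ (L : Type) [Field L] [NumberField L], poitouTate_sum_localTatePairing_eq_zero L)
    (hGZK : rank_eq_analyticRank_of_analyticRank_le_one) (hmod : hasEntireLFunction_rat)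
    (hCT : ∀ (L : Type) [Field L] [NumberField L], casselsTate_levelInputs L)
    (hPrim : shimuraCurve_heegnerSystem_primitivesAtThree)
    (hsurj : Surj W 3) (hirr : W.HasIrreducibleModPGaloisRep 3) (h3N : 3 ∣ N) :
    ∀ (X : ShimuraCurveData (∏ q ∈ S, q) (N / ∏ q ∈ S, q)) (W' : WeierstrassCurve ℚ) [W'.IsElliptic]
      (P₀ : ShimuraParametrizationData X W'), P₀.IsMinimalFor W →
      ∃ (P : (W.baseChange K).toAffine.Point) (degS : ℕ), 0 < degS ∧
        padicValNat 3 degS = padicValNat 3 P₀.deg ∧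
        LDerivEK W K =
          8 * (Real.pi : ℂ) ^ 2 * peterssonProduct (Gamma0 N) 2 Dt.f Dt.f /
              ((((Units.torsionOrder K : ℝ) / 2) ^ 2 * √|(NumberField.discr K : ℝ)| : ℝ) : ℂ) *
            ((P.canonicalHeight : ℂ) / (degS : ℂ)) ∧
        (¬ IsOfFinAddOrder P →
          Nat.card (AddCommGroup.primaryComponent (W.baseChange K).sha 3) ≤
            3 ^ (2 * padicValNat 3 (AddSubgroup.zmultiples P).index)) := by
  haveI : Fact (Nat.Prime 3) := ⟨Nat.prime_three⟩
  intro X W' _ P₀ hP₀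
  obtain ⟨P, degS, h0, hv, hL⟩ := hGZ3 W 3 N K S Dt X W' P₀ hN (by decide) hirr hK hSeven hSin hsplitN h3 hP₀
  exact ⟨P, degS, h0, hv, hL, fun hnt ↦
    ShimuraKolyvaginSurjNamedPrimitivesAtThree.shimuraKolyvaginOrderBoundAtThreeSurj_of_poitouTate_of_GZK_of_modularity_of_casselsTateLevelInputs_of_primitivesAtThree
      hPT hGZK hmod hCT hPrim W 3 N K S Dt X W' P₀ hN hsurj (by decide) hirr hK hSeven hSin hsplitN h3 hP₀ h3N rfl
      P degS h0 hv hL hnt⟩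

end Sources

/-- **U₁ AT A LEAF CURVE WITH `ρ̄₃` ONTO, ON A «SHIMURA ROW», FROM PRINTED THEOREMS TAKEN BY NAME AND L₀ — no Σ, no JSW flag.** The
two-carrier quotable form (part 6) with the Heegner datum from Source 2: for `W/ℚ` globally minimal, non-CM, additive of cell
`(G) ∧ ss` at `3`, `r_an = 1`, `ρ̄_{E,3}` ONTO, carrying a datum with `3 ∤ c`; two distinct split-multiplicative primes `q₁, q₂` with `q₂`
odd, `q₂ ≢ 1 (mod 3)`; every other split-multiplicative prime with `3 ∤ ord Δ_min`; SHAPE. Inputs BY NAME: GZK, modularity (`hmod`,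
`hnf`), Jacquet–Langlands, Pasten 2024 §6 component orders, Cai–Shu–Tian Thm. 1.5 on `X_{N⁺,N⁻}` (printed companion), Poitou–Tate (sum
form), Cassels–Tate level inputs, the Heegner-system primitives at `3`, Friedberg–Hoffstein inert-split; and the route member L₀.
CONDITIONAL; nothing booked; BSD is not proved. [cite: McCallumLMS1991, §1 Theorem (Kolyvagin)] [cite: CaiShuTian2014, Thm. 1.5]
[cite: PastenShimura2024, Prop. 6.13, Lemma 6.18 (pp. 23–24)] [cite: FriedbergHoffstein1995, Thm. B] [cite: Miller2011LMS, Def. 1.1] -/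
theorem leafRankOneUpper_three_of_twoCarriers_of_lowerRankZero_of_primitives
    -- published inputs (named facts of the tree), all printed theorems
    (hGZK : rank_eq_analyticRank_of_analyticRank_le_one) (hmod : hasEntireLFunction_rat)
    (hnf : exists_isNewformOf) (hJL : nonempty_shimuraParametrizationData)
    (hCO : PastenShimura2024_componentOrders)
    (hGZ3 : shimuraCurve_heegnerPoint_grossZagier)
    (hPT : ∀ (L : Type) [Field L] [NumberField L], poitouTate_sum_localTatePairing_eq_zero L)
    (hCT : ∀ (L : Type) [Field L] [NumberField L], casselsTate_levelInputs L)
    (hPrim : shimuraCurve_heegnerSystem_primitivesAtThree)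
    (hFH2 : friedbergHoffstein_exists_twist_ne_zero_inertAt_splitAt)
    -- the route member L₀ BY NAME
    (hL0 : Summit.BirchSwinnertonDyer.BirchSwinnertonDyer.Theses.RamifiedHeegnerPair.Gss2LowerAtThreeRankZero)
    -- the leaf curve (ρ̄₃ onto), with a datum whose constant is a `3`-unit
    (W : WeierstrassCurve ℚ) [W.IsElliptic] [W.IsGloballyMinimal]
    (hCM : ¬ W.HasCM) (hadd : Addv W 3) (hsub : SubGss W 3) (hr : W.analyticRank = 1) (hsurj : Surj W 3)
    {N : ℕ} [NeZero N] (hN : W.conductorNorm ℤ = N)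
    (Dt : ModularParametrizationData W N) (hc : ¬ (3 : ℤ) ∣ Dt.c)
    -- the two carriers and the shape
    {q₁ q₂ : ℕ} [Fact q₁.Prime] [Fact q₂.Prime] (hne : q₁ ≠ q₂)
    (h₁ : W.HasSplitMultiplicativeReductionAtPrime q₁) (h₂ : W.HasSplitMultiplicativeReductionAtPrime q₂)
    (hothers : ∀ (ℓ : ℕ) [Fact ℓ.Prime], ℓ ≠ q₁ → ℓ ≠ q₂ → W.HasSplitMultiplicativeReductionAtPrime ℓ →
      ¬ 3 ∣ padicValInt ℓ W.minimalDiscriminantInt)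
    (hq₂2 : q₂ ≠ 2) (hq₂1 : q₂ % 3 ≠ 1)
    (hshape : ∀ (q : ℕ) [Fact q.Prime], 3 ∣ (W.baseChange ℚ_[q]).localTamagawaNumber ℤ_[q] →
      W.HasSplitMultiplicativeReductionAtPrime q) :
    Typed.MissingUpperBoundAt W 3 := by
  haveI h3F : Fact (Nat.Prime 3) := ⟨Nat.prime_three⟩
  have hp : (3 : ℕ).Prime := Nat.prime_three
  subst hN
  obtain ⟨hSeven, hSmult, hFC, hDEG⟩ := inertPair_data W hne h₁ h₂ hothers hq₂2 hq₂1
  have hirr : W.HasIrreducibleModPGaloisRep 3 := Additive.irr_of_subGss_of_ne_two W 3 (by decide) hadd hsub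
  -- the sign of the functional equation is `−1` (modularity, `r_an = 1`)
  have hw : W.rootNumber = -1 := by
    rw [WeierstrassCurve.rootNumber_eq_neg_one_pow_analyticRank_of_exists_isNewformOf hnf W, hr]
    norm_num
  -- the field of JSW §7.4.2 with `2` split unless inert
  obtain ⟨K, _, _, hK, -, hinert, hsplitN, hsplit2, hLt⟩ :=
    hFH2 W hw {q₁, q₂} hSmult hSeven 2 two_ne_zero 4
  have hodd : Odd (NumberField.discr K) := by
    by_cases h2S : 2 ∈ ({q₁, q₂} : Finset ℕ)
    · obtain ⟨hn, hd⟩ := hinert 2 h2S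
      exact odd_discr_of_two_inert_or_split hK.1
        (Or.inl ⟨by simpa only [Nat.cast_ofNat] using hn, by simpa only [Nat.cast_ofNat] using hd⟩)
    · have hn := hsplit2 2 Nat.prime_two (dvd_refl 2) h2S
      exact odd_discr_of_two_inert_or_split hK.1 (Or.inr (by simpa only [Nat.cast_ofNat] using hn))
  -- `3` splits (it is a bad prime outside `S`)
  have hbad3 : ¬ W.HasGoodReductionAtPrime 3 := not_good_of_addv W 3 hadd
  have h3S : 3 ∉ ({q₁, q₂} : Finset ℕ) := by
    intro h
    obtain ⟨_, hm⟩ := hSmult 3 h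
    exact not_mult_of_addv W 3 hadd hm
  have h3N : 3 ∣ W.conductorNorm ℤ := (W.dvd_conductorNorm_iff_not_hasGoodReductionAtPrime 3).mpr hbad3
  have hps2 : ((Ideal.span {((3 : ℕ) : ℤ)}).primesOver (𝓞 K)).ncard = 2 := hsplitN 3 hp h3N h3S
  have hH3 : SatisfiesHeegnerHypothesis 3 K := fun q hq hq3 ↦ by
    have : q = 3 := (Nat.prime_dvd_prime_iff_eq hq hp).mp hq3
    subst this; exact hps2
  -- the inert primes are `∥ N`
  have hSin : ∀ ℓ ∈ ({q₁, q₂} : Finset ℕ), ℓ.Prime ∧ ℓ ∣ W.conductorNorm ℤ ∧ ¬ ℓ ^ 2 ∣ W.conductorNorm ℤ ∧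
      ((Ideal.span {(ℓ : ℤ)}).primesOver (𝓞 K)).ncard = 1 ∧ ¬ (ℓ : ℤ) ∣ NumberField.discr K := by
    intro ℓ hℓ
    obtain ⟨hℓF, hm⟩ := hSmult ℓ hℓ
    obtain ⟨hn, hd⟩ := hinert ℓ hℓ
    have hℓN : ℓ ∣ W.conductorNorm ℤ :=
      (W.dvd_conductorNorm_iff_not_hasGoodReductionAtPrime ℓ).mpr
        (WeierstrassCurve.HasMultiplicativeReduction.not_hasGoodReduction (R := ℤ_[ℓ]) hm)
    exact ⟨hℓF.out, hℓN, not_sq_dvd_conductorNorm_of_mult W ℓ hm, hn, hd⟩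
  exact leafRankOneUpper_three_of_shimuraInertDatum_at hGZK hmod hnf hJL hCO W hadd hsub hr rfl Dt hc {q₁, q₂} hSeven
    hSmult hFC hshape hDEG K hK hodd hinert hsplitN hLt
    (shimuraHeegnerAt_of_primitives_of_surj W rfl K hK {q₁, q₂} hSeven hSin hsplitN hps2 Dt hGZ3 hPT hGZK hmod hCT hPrim
      hsurj hirr h3N)
    (fun Wd _ _ Cd hWd ↦ partnerLowerSplitThree_of_lowerRankZero hmod hL0 W hCM hadd hsub K hK hodd hH3 hLt Wd Cd hWd)

end Summit.BirchSwinnertonDyer.BirchSwinnertonDyer.Theorems.LeafShimuraInert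

end
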